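import Literature.NumberTheory.LFunctions.RayClassLogFreeLemmaB
import Literature.NumberTheory.LFunctions.ClassGroupLogFreeZeroSide
import HarnessLib

/-!
# Bombieri's Théorème 14 for the characters of a congruence class group `mod 𝔪`, I: the zero side

Topic `Literature/NumberTheory/LFunctions`, namespace `Literature.NumberTheory.LFunctions`.
Everything here is PROVED (one definition with body, theorems; no named facts).

The ray-class counterpart of the tree's `ClassGroupLogFreeZeroSide(AllDegrees).lean` (conductor `1`), for the
entire Hecke `L`-function `L` of the primitive associate of a ray class character `ψ mod 𝔪`, non-principal on the
primes `∤ 𝔪` (primitive data `D`, `RayClassLFunctionLocal.lean`):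
* the mean values `I(v) = ∫_{(⌊x^{a₀}⌋, x]} ‖S_v(t)‖² dt/t` of the sifted sums of `RayClassLogFreeLemmaB`
  (`RayClassPrimitiveData.meanValue`), their measurability/integrability in `v` and the Fubini interchange
  (verbatim from the tree up to the coefficients);
* `overlap_le_CG` — the zeros within `r/2` in height of `v` with `1 − β ≤ r/2` have multiplicity `≤ 4(1 + rℒ')`
  (Lemme de densité, `localCount_le`);
* `zeroSide_rayClass_of_le (n)` — **the zero side**, every degree: summing Lemme B (`lemmeB_rayClass_of_le`) over
  a finite set of zeros of `L` with `1 − r/2 ≤ β < 1`, `|γ| + r/2 ≤ T'`: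
  `r · e^{−10} x^{−r/10} r^{−3}/n² · Σ_ρ m(ρ) ≤ C (rL') ∫_{−T'}^{T'} I(v) dv`.

## References
* [Bombieri1987GrandCrible] E. Bombieri, Astérisque 18 (1987), §6 Théorème 14, pp. 48–50.
* [ThornerZaman2017] J. Thorner, A. Zaman, Algebra Number Theory 11 (2017), §5.
* [Weiss1983] A. Weiss, J. reine angew. Math. 338 (1983), §4.
-/

noncomputable section

open Complex Finset Filter Real MeasureTheory NumberField IsDedekindDomain
open scoped LSeries.notation ArithmeticFunction.vonMangoldt Topology Nat NumberField

namespace Literature.NumberTheory.LFunctions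

open Literature.NumberTheory.LFunctions.LogFreeLocal Literature.NumberTheory.LFunctions.LogFreeDensity
  Literature.NumberTheory.LFunctions.NumberField
open scoped nonZeroDivisors

variable {K : Type*} [Field K] [NumberField K] {𝔪 : Ideal (𝓞 K)} {ψ : HeightOneSpectrum (𝓞 K) → ℂ}

namespace RayClassPrimitiveData

variable (D : RayClassPrimitiveData 𝔪 ψ)

/-! ### Measurability and integrability of the mean values -/

/-- `v ↦ b_n(χ, v)` restricted to the sifted set is continuous. [cite: Bombieri1987GrandCrible, §6 Théorème 14 (proof)] -/
theorem continuous_coefSiftedB_coefB (x : ℝ) (z n : ℕ) :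
    Continuous fun v : ℝ => coefSiftedB (D.coefB v) x z n := by
  by_cases h : n ∈ (Ioc ⌊x ^ expoB⌋₊ ⌊x⌋₊).filter (fun n => IsPrimePow n ∧ z < n.minFac)
  · have hn : n ≠ 0 := by
      rw [← siftedSet] at h; have := (siftedSet_prop h).1; omega
    have heq : (fun v : ℝ => coefSiftedB (D.coefB v) x z n) =
        fun v : ℝ => twistVonMangoldt K (rayClassCoeffHom D.𝔣 D.χ₀) n *
          ((n : ℂ)⁻¹ * Complex.exp (-((v : ℂ) * (Real.log n : ℂ)) * Complex.I)) / (Module.finrank ℚ K : ℂ) := by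
      funext v
      rw [coefSiftedB, if_pos h, RayClassPrimitiveData.coefB, natCast_cpow_neg_one_add_mul_I hn]
    rw [heq]
    refine (continuous_const.mul (continuous_const.mul ?_)).div_const _
    refine Complex.continuous_exp.comp ?_
    exact ((Complex.continuous_ofReal.mul continuous_const).neg).mul continuous_const
  · have heq : (fun v : ℝ => coefSiftedB (D.coefB v) x z n) = fun _ => 0 := by
      funext v; rw [coefSiftedB, if_neg h]
    rw [heq]; exact continuous_const

/-- The two-variable integrand `F(v, t) = ‖S_{χ,v}(t)‖²/t` is measurable. [cite: Bombieri1987GrandCrible, §6 Théorème 14 (proof)] -/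
theorem measurable_normSq_summatory_CG (x : ℝ) (z : ℕ) :
    Measurable fun p : ℝ × ℝ => ‖summatory (coefSiftedB (D.coefB p.1) x z) p.2‖ ^ 2 / p.2 := by
  -- `H(v, m) = ∑_{i ≤ m} b_i(v)` is measurable on `ℝ × ℕ`
  have hH : Measurable fun p : ℝ × ℕ => ∑ i ∈ Icc 0 p.2, coefSiftedB (D.coefB p.1) x z i := by
    refine measurable_from_prod_countable_left fun m => ?_
    show Measurable fun v : ℝ => ∑ i ∈ Icc 0 m, coefSiftedB (D.coefB v) x z i
    exact (continuous_finsetSum _ fun i _ => D.continuous_coefSiftedB_coefB x z i).measurable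
  have hfl : Measurable fun p : ℝ × ℝ => (p.1, ⌊p.2⌋₊) :=
    measurable_fst.prodMk (Nat.measurable_floor.comp measurable_snd)
  have hS : Measurable fun p : ℝ × ℝ => summatory (coefSiftedB (D.coefB p.1) x z) p.2 := by
    have : (fun p : ℝ × ℝ => summatory (coefSiftedB (D.coefB p.1) x z) p.2) =
        (fun p : ℝ × ℕ => ∑ i ∈ Icc 0 p.2, coefSiftedB (D.coefB p.1) x z i) ∘ fun p : ℝ × ℝ => (p.1, ⌊p.2⌋₊) := by
      funext p; rfl
    rw [this]; exact hH.comp hfl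
  exact (hS.norm.pow_const 2).div measurable_snd

/-- Uniform bound: `‖S_{χ,v}(t)‖²/t ≤ (∑_{i ≤ ⌊x⌋} Λ(i)/i)²` for `t ≥ 1`. [cite: Bombieri1987GrandCrible, §6 Théorème 14 (proof)] -/
theorem normSq_summatory_div_le_CG (v x : ℝ) (z : ℕ) {t : ℝ}
    (ht : 1 ≤ t) (htx : t ≤ x) :
    ‖summatory (coefSiftedB (D.coefB v) x z) t‖ ^ 2 / t ≤ (∑ i ∈ Icc 0 ⌊x⌋₊, Λ i / i) ^ 2 := by
  have hfl : ⌊t⌋₊ ≤ ⌊x⌋₊ := Nat.floor_le_floor htx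
  have h1 : ‖summatory (coefSiftedB (D.coefB v) x z) t‖ ≤ ∑ i ∈ Icc 0 ⌊x⌋₊, Λ i / i :=
    (norm_summatory_le _ hfl).trans (sum_le_sum fun i _ => norm_coefSiftedB_le (D.norm_coefB_le v) x z i)
  calc ‖summatory (coefSiftedB (D.coefB v) x z) t‖ ^ 2 / t ≤ ‖summatory (coefSiftedB (D.coefB v) x z) t‖ ^ 2 :=
        div_le_self (by positivity) ht
    _ ≤ _ := pow_le_pow_left₀ (norm_nonneg _) h1 2

/-- The mean value `I_χ(v) = ∫_{(⌊x^{a₀}⌋, x]} ‖S_{χ,v}(t)‖²/t dt`. [cite: Bombieri1987GrandCrible, §6 Lemme B] -/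
def meanValue (x : ℝ) (z : ℕ) (v : ℝ) : ℝ :=
  ∫ t in Set.Ioc (⌊x ^ expoB⌋₊ : ℝ) x, ‖summatory (coefSiftedB (D.coefB v) x z) t‖ ^ 2 / t

/-- `I_χ(v) ≥ 0`. [cite: Bombieri1987GrandCrible, §6 Théorème 14 (proof)] -/
theorem meanValue_nonneg (x : ℝ) (z : ℕ) (v : ℝ) :
    0 ≤ D.meanValue x z v :=
  setIntegral_nonneg measurableSet_Ioc fun t ht => by
    have : (0 : ℝ) ≤ t := le_trans (Nat.cast_nonneg _) ht.1.le
    positivity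

/-- `I_χ(v) ≤ (∑_{i ≤ x} Λ(i)/i)² · x` (a crude uniform bound). [cite: Bombieri1987GrandCrible, §6 Théorème 14 (proof)] -/
theorem meanValue_le {x : ℝ} (hx : 1 ≤ x) (z : ℕ) (v : ℝ)
    (hNX : 1 ≤ ⌊x ^ expoB⌋₊) :
    D.meanValue x z v ≤ (∑ i ∈ Icc 0 ⌊x⌋₊, Λ i / i) ^ 2 * x := by
  unfold meanValue
  have hvol : volume (Set.Ioc (⌊x ^ expoB⌋₊ : ℝ) x) < ⊤ := measure_Ioc_lt_top
  calc ∫ t in Set.Ioc (⌊x ^ expoB⌋₊ : ℝ) x, ‖summatory (coefSiftedB (D.coefB v) x z) t‖ ^ 2 / t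
      ≤ ∫ t in Set.Ioc (⌊x ^ expoB⌋₊ : ℝ) x, (∑ i ∈ Icc 0 ⌊x⌋₊, Λ i / i) ^ 2 := by
        refine setIntegral_mono_on ?_ (integrableOn_const hvol.ne) measurableSet_Ioc fun t ht => ?_
        · exact integrableOn_normSq_summatory_div _ x hNX
        · exact D.normSq_summatory_div_le_CG v x z (le_trans (by exact_mod_cast hNX) ht.1.le) ht.2
    _ = (∑ i ∈ Icc 0 ⌊x⌋₊, Λ i / i) ^ 2 * (x - ⌊x ^ expoB⌋₊) := by
        have hle : (⌊x ^ expoB⌋₊ : ℝ) ≤ x :=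
          (Nat.floor_le (by positivity)).trans (Real.rpow_le_self_of_one_le hx (by
            linarith [expoB_le_half]))
        rw [setIntegral_const, smul_eq_mul, mul_comm, Measure.real, Real.volume_Ioc,
          ENNReal.toReal_ofReal (by linarith)]
    _ ≤ (∑ i ∈ Icc 0 ⌊x⌋₊, Λ i / i) ^ 2 * x := by
        refine mul_le_mul_of_nonneg_left (by linarith [(Nat.cast_nonneg ⌊x ^ expoB⌋₊ : (0:ℝ) ≤ _)]) (by positivity)

/-- `v ↦ I_χ(v)` is measurable (Fubini). [cite: Bombieri1987GrandCrible, §6 Théorème 14 (proof)] -/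
theorem measurable_meanValue (x : ℝ) (z : ℕ) :
    Measurable (D.meanValue x z) := by
  unfold meanValue
  have h := (D.measurable_normSq_summatory_CG x z).stronglyMeasurable.integral_prod_right'
    (ν := volume.restrict (Set.Ioc (⌊x ^ expoB⌋₊ : ℝ) x))
  exact h.measurable

/-- `I_χ` is integrable on every bounded interval. [cite: Bombieri1987GrandCrible, §6 Théorème 14 (proof)] -/
theorem integrableOn_meanValue {x : ℝ} (hx : 1 ≤ x) (z : ℕ)
    (hNX : 1 ≤ ⌊x ^ expoB⌋₊) (a b : ℝ) :
    IntegrableOn (D.meanValue x z) (Set.Icc a b) := by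
  refine Measure.integrableOn_of_bounded (M := (∑ i ∈ Icc 0 ⌊x⌋₊, Λ i / i) ^ 2 * x)
    measure_Icc_lt_top.ne (D.measurable_meanValue x z).aestronglyMeasurable ?_
  refine Eventually.of_forall fun v => ?_
  rw [Real.norm_eq_abs, abs_of_nonneg (D.meanValue_nonneg x z v)]
  exact D.meanValue_le hx z v hNX

/-! ### The zero side: summing Lemme B over the zeros of one character -/


/-! ### Fubini: from `∫_v I_χ(v) dv` to `∫_t (∫_v ‖S‖²)/t dt` -/

/-- The function `(v, t) ↦ ‖S_{χ,v}(t)‖²/t` is integrable on `[−T', T'] × (⌊x^{a₀}⌋, x]`. [cite: Bombieri1987GrandCrible, §6 Théorème 14 (proof)] -/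
theorem integrable_normSq_prod_CG (x : ℝ) (z : ℕ)
    (hNX : 1 ≤ ⌊x ^ expoB⌋₊) (T' : ℝ) :
    Integrable (Function.uncurry fun v t : ℝ => ‖summatory (coefSiftedB (D.coefB v) x z) t‖ ^ 2 / t)
      ((volume.restrict (Set.Ioc (-T') T')).prod (volume.restrict (Set.Ioc (⌊x ^ expoB⌋₊ : ℝ) x))) := by
  set Sv : Set ℝ := Set.Ioc (-T') T' with hSv
  set St : Set ℝ := Set.Ioc (⌊x ^ expoB⌋₊ : ℝ) x with hSt
  set F : ℝ → ℝ → ℝ := fun v t => ‖summatory (coefSiftedB (D.coefB v) x z) t‖ ^ 2 / t with hF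
  have hmeas : Measurable (Function.uncurry F) := D.measurable_normSq_summatory_CG x z
  have hbound : ∀ p ∈ Sv ×ˢ St, ‖Function.uncurry F p‖ ≤ (∑ i ∈ Icc 0 ⌊x⌋₊, Λ i / i) ^ 2 := by
    rintro ⟨v, t⟩ ⟨-, ht⟩
    rw [hSt] at ht
    have ht1 : (1 : ℝ) ≤ t := le_trans (by exact_mod_cast hNX) ht.1.le
    rw [Function.uncurry_apply_pair, Real.norm_eq_abs, abs_of_nonneg (by rw [hF]; positivity)]
    exact D.normSq_summatory_div_le_CG v x z ht1 ht.2
  rw [Measure.prod_restrict, ← Measure.volume_eq_prod]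
  refine Measure.integrableOn_of_bounded (M := (∑ i ∈ Icc 0 ⌊x⌋₊, Λ i / i) ^ 2) ?_
    hmeas.aestronglyMeasurable ?_
  · rw [Measure.volume_eq_prod, Measure.prod_prod]
    exact ENNReal.mul_ne_top measure_Ioc_lt_top.ne measure_Ioc_lt_top.ne
  · rw [ae_restrict_iff' (measurableSet_Ioc.prod measurableSet_Ioc)]
    exact Eventually.of_forall hbound

/-- **Interchange of the `v`- and `t`-integrals.** [cite: Bombieri1987GrandCrible, §6 Théorème 14 (proof)] -/
theorem integral_meanValue_eq (x : ℝ) (z : ℕ)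
    (hNX : 1 ≤ ⌊x ^ expoB⌋₊) {T' : ℝ} (hT' : 0 ≤ T') :
    ∫ v in (-T')..T', D.meanValue x z v =
      ∫ t in Set.Ioc (⌊x ^ expoB⌋₊ : ℝ) x,
        (∫ v in (-T')..T', ‖summatory (coefSiftedB (D.coefB v) x z) t‖ ^ 2) / t := by
  have hswap := integral_integral_swap (D.integrable_normSq_prod_CG x z hNX T')
  rw [intervalIntegral.integral_of_le (by linarith)]
  unfold meanValue
  rw [show (∫ v in Set.Ioc (-T') T', ∫ t in Set.Ioc (⌊x ^ expoB⌋₊ : ℝ) x,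
      ‖summatory (coefSiftedB (D.coefB v) x z) t‖ ^ 2 / t) =
      ∫ v in Set.Ioc (-T') T', ∫ t in Set.Ioc (⌊x ^ expoB⌋₊ : ℝ) x,
        (fun v t : ℝ => ‖summatory (coefSiftedB (D.coefB v) x z) t‖ ^ 2 / t) v t from rfl, hswap]
  refine setIntegral_congr_fun measurableSet_Ioc fun t _ => ?_
  rw [intervalIntegral.integral_of_le (by linarith), ← integral_div]

/-- The inner `v`-integral divided by `t` is integrable in `t`. [cite: Bombieri1987GrandCrible, §6 Théorème 14 (proof)] -/
theorem integrableOn_inner_CG (x : ℝ) (z : ℕ)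
    (hNX : 1 ≤ ⌊x ^ expoB⌋₊) {T' : ℝ} (hT' : 0 ≤ T') :
    IntegrableOn (fun t => (∫ v in (-T')..T', ‖summatory (coefSiftedB (D.coefB v) x z) t‖ ^ 2) / t)
      (Set.Ioc (⌊x ^ expoB⌋₊ : ℝ) x) := by
  have h := (D.integrable_normSq_prod_CG x z hNX T').integral_prod_right
  refine (h.congr (Eventually.of_forall fun t => ?_))
  simp only [Function.uncurry_apply_pair]
  rw [intervalIntegral.integral_of_le (by linarith), ← integral_div]

/-! ### Elementary: `∑_{n ≤ N} Λ(n)²/n ≤ log N (log N + log 4 + 2)` -/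

/-! ### The zero side: summing Lemme B over the zeros of one character -/

/-- The multiplicity-weighted number of zeros of `L₀(·, χ)` within `r/2` in height of `v` (and with
`1 − β ≤ r/2`) is at most `4(1 + rℒ'_v)`: they lie in `|ρ − (1+iv)| ≤ r` (Lemme de densité).
[cite: Bombieri1987GrandCrible, §6 Théorème 14 (proof)] -/
theorem overlap_le_CG (hnt : ∃ v : HeightOneSpectrum (𝓞 K), ¬ 𝔪 ≤ v.asIdeal ∧ ψ v ≠ 1) {r : ℝ} (hr : 0 < r) (hr4 : r ≤ 1 / 4)
    (Zρ : Finset ℂ) (hZ : ∀ ρ ∈ Zρ, D.L ρ = 0 ∧ 1 - r / 2 ≤ ρ.re ∧ ρ.re < 1) (v : ℝ) :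
    ∑ ρ ∈ Zρ.filter (fun ρ => |ρ.im - v| ≤ r / 2), (zeroOrder (D.L) ρ : ℝ) ≤
      4 * (1 + r * rayLemmaAHeight K 𝔪 v) := by
  classical
  set f := D.L with hf
  have hdf : Differentiable ℂ f := D.differentiable
  have hfc : f (2 + (v : ℂ) * I) ≠ 0 := D.L_two_add_ne_zero hnt v
  set W := Zρ.filter (fun ρ => |ρ.im - v| ≤ r / 2) with hW
  have hmem : ∀ ρ ∈ W, ρ ∈ discZeros f v ∧ ‖ρ - (1 + (v : ℂ) * I)‖ ≤ r := by
    intro ρ hρ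
    rw [hW, mem_filter] at hρ
    obtain ⟨hρZ, hγ⟩ := hρ
    obtain ⟨h0, hβ, hβ1⟩ := hZ ρ hρZ
    have hnorm : ‖ρ - (1 + (v : ℂ) * I)‖ ≤ r := by
      have hre : (ρ - (1 + (v : ℂ) * I)).re = ρ.re - 1 := by simp
      have him : (ρ - (1 + (v : ℂ) * I)).im = ρ.im - v := by simp
      calc ‖ρ - (1 + (v : ℂ) * I)‖ ≤ |(ρ - (1 + (v : ℂ) * I)).re| + |(ρ - (1 + (v : ℂ) * I)).im| :=
            Complex.norm_le_abs_re_add_abs_im _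
        _ ≤ r / 2 + r / 2 := by
            rw [hre, him]
            refine add_le_add ?_ hγ
            rw [abs_sub_comm, abs_of_nonneg (by linarith)]; linarith
        _ = r := by ring
    refine ⟨(mem_discZeros hdf hfc).2 ⟨?_, h0⟩, hnorm⟩
    rw [Metric.mem_closedBall, dist_eq_norm]
    calc ‖ρ - (2 + (v : ℂ) * I)‖ = ‖(ρ - (1 + (v : ℂ) * I)) - 1‖ := by ring_nf
      _ ≤ ‖ρ - (1 + (v : ℂ) * I)‖ + ‖(1 : ℂ)‖ := norm_sub_le _ _
      _ ≤ r + 1 := by rw [norm_one]; linarith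
      _ ≤ 31 / 16 := by linarith
  have hsub : W ⊆ (discZeros f v).filter (fun ρ => ‖ρ - (1 + (v : ℂ) * I)‖ ≤ r) := by
    intro ρ hρ; rw [mem_filter]; exact hmem ρ hρ
  calc ∑ ρ ∈ W, (zeroOrder f ρ : ℝ) = ∑ ρ ∈ W, (discDivisor f v ρ : ℝ) := by
        refine sum_congr rfl fun ρ hρ => ?_
        rw [discDivisor_eq_zeroOrder hdf hfc ((mem_discZeros hdf hfc).1 (hmem ρ hρ).1).1]; norm_cast
    _ ≤ ∑ ρ ∈ (discZeros f v).filter (fun ρ => ‖ρ - (1 + (v : ℂ) * I)‖ ≤ r), (discDivisor f v ρ : ℝ) :=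
        sum_le_sum_of_subset_of_nonneg hsub fun ρ _ _ => by exact_mod_cast discDivisor_nonneg hdf v ρ
    _ ≤ _ := D.localCount_le hnt v hr hr4

end RayClassPrimitiveData

/-- **The zero side of Théorème 14 for `L₀(s, χ)` in every degree** (Bombieri pp. 49–50), `χ ≠ 1`,
`n_K ≤ n`, `L₀ ≠ 0` on `Re s ≥ 1`: there are `A₀, r₀, C > 0` depending only on `n` such that for
`ℒ'_v ≤ L'` on `|v| ≤ T'`,
`0 < r ≤ r₀`, `rL' ≥ 1`, `1 ≤ x`, `log x ≥ A₀ L'`, `z ≤ x^{a₀/2}`, and any finite set `Z` of zeros of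
`L₀(·, χ)` with `1 − r/2 ≤ β < 1`, `|γ| + r/2 ≤ T'`,
`r · (e^{−10} x^{−r/10} r^{−3}/n²) · Σ_{ρ ∈ Z} m(ρ) ≤ C (rL') ∫_{−T'}^{T'} I_χ(v) dv`.
[cite: Bombieri1987GrandCrible, §6 Théorème 14 (proof)] -/
theorem zeroSide_rayClass_of_le (n : ℕ) :
    ∃ A₀ r₀ C : ℝ, 0 < A₀ ∧ 0 < r₀ ∧ 0 < C ∧
      ∀ (K : Type*) [Field K] [NumberField K] (𝔪 : Ideal (𝓞 K)) (ψ : HeightOneSpectrum (𝓞 K) → ℂ)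
        (D : RayClassPrimitiveData 𝔪 ψ), (∃ v : HeightOneSpectrum (𝓞 K), ¬ 𝔪 ≤ v.asIdeal ∧ ψ v ≠ 1) →
        Module.finrank ℚ K ≤ n →
        ∀ (T' r L' x : ℝ) (z : ℕ) (Zρ : Finset ℂ),
        (∀ v : ℝ, |v| ≤ T' → rayLemmaAHeight K 𝔪 v ≤ L') → 0 < r → r ≤ r₀ → 1 ≤ r * L' → 1 ≤ x →
        A₀ * L' ≤ Real.log x → (z : ℝ) ≤ x ^ (expoB / 2) → 0 ≤ T' →
        (∀ ρ ∈ Zρ, D.L ρ = 0 ∧ 1 - r / 2 ≤ ρ.re ∧ ρ.re < 1 ∧ |ρ.im| + r / 2 ≤ T') →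
          r * (Real.exp (-10) / (n : ℝ) ^ 2 * x ^ (-(r / 10)) / r ^ 3) *
              ∑ ρ ∈ Zρ, (zeroOrder (D.L) ρ : ℝ) ≤
            C * (r * L') * ∫ v in (-T')..T', D.meanValue x z v := by
  obtain ⟨A₀, r₀, hA₀, hr₀, hB⟩ := lemmeB_rayClass_of_le n
  refine ⟨A₀, min r₀ (1 / 4), 2 * 4, hA₀, by positivity, by positivity,
    fun K _ _ 𝔪 ψ D hnt hnK T' r L' x z Zρ hLL' hr hrmin hu hx hlogx hz hT' hZ => ?_⟩
  classical
  set f := D.L with hf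
  have hdf : Differentiable ℂ f := D.differentiable
  have hr0 : r ≤ r₀ := hrmin.trans (min_le_left _ _)
  have hr4 : r ≤ 1 / 4 := hrmin.trans (min_le_right _ _)
  set L₀ : ℝ := Real.exp (-10) / (n : ℝ) ^ 2 * x ^ (-(r / 10)) / r ^ 3 with hL₀
  set A : Set ℝ := Set.Icc (-T') T' with hA
  have hxpos : 0 < x := by linarith
  have hNX : 1 ≤ ⌊x ^ expoB⌋₊ := Nat.le_floor (by
    simp only [Nat.cast_one]; exact Real.one_le_rpow hx expoB_pos.le)
  have hint : IntegrableOn (D.meanValue x z) A := D.integrableOn_meanValue hx z hNX _ _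
  -- Lemme B at every `v` within `r/2` of the height of a zero of `Z`
  have hLB : ∀ ρ ∈ Zρ, ∀ v ∈ Set.Icc (ρ.im - r / 2) (ρ.im + r / 2), L₀ ≤ D.meanValue x z v := by
    intro ρ hρ v hv
    obtain ⟨h0, hβ, hβ1, hγT⟩ := hZ ρ hρ
    have hvT : |v| ≤ T' := by
      rw [Set.mem_Icc] at hv
      have h1 : |ρ.im| ≤ T' - r / 2 := by linarith
      have h2 := abs_le.1 h1
      rw [abs_le]; constructor <;> linarith
    have hLL'v : rayLemmaAHeight K 𝔪 v ≤ L' := hLL' v hvT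
    have hγ : |ρ.im - v| ≤ r / 2 := by
      rw [Set.mem_Icc] at hv; rw [abs_le]; constructor <;> linarith
    have hnorm : ‖ρ - (1 + (v : ℂ) * I)‖ ≤ r := by
      have hre : (ρ - (1 + (v : ℂ) * I)).re = ρ.re - 1 := by simp
      have him : (ρ - (1 + (v : ℂ) * I)).im = ρ.im - v := by simp
      calc ‖ρ - (1 + (v : ℂ) * I)‖ ≤ |(ρ - (1 + (v : ℂ) * I)).re| + |(ρ - (1 + (v : ℂ) * I)).im| :=
            Complex.norm_le_abs_re_add_abs_im _
        _ ≤ r / 2 + r / 2 := by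
            rw [hre, him]
            refine add_le_add ?_ hγ
            rw [abs_sub_comm, abs_of_nonneg (by linarith)]; linarith
        _ = r := by ring
    exact hB K 𝔪 ψ D hnt hnK v r L' x z hLL'v hr hr0 hu ⟨ρ, h0, hnorm⟩ hxpos hlogx hz
  -- per zero: `r L₀ ≤ ∫_A 𝟙_{J_ρ} I`
  have hper : ∀ ρ ∈ Zρ, r * L₀ ≤
      ∫ v in A, (Set.Icc (ρ.im - r / 2) (ρ.im + r / 2)).indicator (D.meanValue x z) v := by
    intro ρ hρ
    obtain ⟨-, -, -, hγT⟩ := hZ ρ hρ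
    set J : Set ℝ := Set.Icc (ρ.im - r / 2) (ρ.im + r / 2) with hJ
    have hJA : J ⊆ A := by
      intro v hv
      rw [hJ, Set.mem_Icc] at hv
      rw [hA, Set.mem_Icc]
      have h1 : |ρ.im| ≤ T' - r / 2 := by linarith
      have h2 := abs_le.1 h1
      constructor <;> linarith
    rw [setIntegral_indicator measurableSet_Icc, Set.inter_eq_right.2 hJA]
    have hvol : volume.real J = r := by
      rw [hJ, Measure.real, Real.volume_Icc, ENNReal.toReal_ofReal (by linarith)]; ring
    have h := setIntegral_ge_of_const_le_real (c := L₀) measurableSet_Icc measure_Icc_lt_top.ne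
      (fun v hv => hLB ρ hρ v hv) (hint.mono_set hJA)
    rw [hvol] at h
    linarith
  have hsum : r * L₀ * ∑ ρ ∈ Zρ, (zeroOrder f ρ : ℝ) ≤
      ∫ v in A, ∑ ρ ∈ Zρ, (zeroOrder f ρ : ℝ) *
        (Set.Icc (ρ.im - r / 2) (ρ.im + r / 2)).indicator (D.meanValue x z) v := by
    rw [mul_sum, integral_finsetSum _ fun ρ _ => (hint.indicator measurableSet_Icc).const_mul _]
    refine sum_le_sum fun ρ hρ => ?_
    rw [integral_const_mul]
    have h0 : (0 : ℝ) ≤ zeroOrder f ρ := Nat.cast_nonneg _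
    calc r * L₀ * (zeroOrder f ρ : ℝ) = (zeroOrder f ρ : ℝ) * (r * L₀) := by ring
      _ ≤ _ := mul_le_mul_of_nonneg_left (hper ρ hρ) h0
  refine hsum.trans ?_
  have hℒ : ∀ v ∈ A, rayLemmaAHeight K 𝔪 v ≤ L' := by
    intro v hv
    rw [hA, Set.mem_Icc] at hv
    exact hLL' v (abs_le.2 ⟨hv.1, hv.2⟩)
  have hpt : ∀ v ∈ A, ∑ ρ ∈ Zρ, (zeroOrder f ρ : ℝ) *
      (Set.Icc (ρ.im - r / 2) (ρ.im + r / 2)).indicator (D.meanValue x z) v ≤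
        (2 * 4 * (r * L')) * D.meanValue x z v := by
    intro v hv
    have heq : ∑ ρ ∈ Zρ, (zeroOrder f ρ : ℝ) *
        (Set.Icc (ρ.im - r / 2) (ρ.im + r / 2)).indicator (D.meanValue x z) v =
        (∑ ρ ∈ Zρ.filter (fun ρ => |ρ.im - v| ≤ r / 2), (zeroOrder f ρ : ℝ)) * D.meanValue x z v := by
      rw [sum_mul, sum_filter]
      refine sum_congr rfl fun ρ _ => ?_
      by_cases h : |ρ.im - v| ≤ r / 2
      · rw [if_pos h, Set.indicator_of_mem]
        rw [Set.mem_Icc]; rw [abs_le] at h; constructor <;> linarith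
      · rw [if_neg h, Set.indicator_of_notMem, mul_zero]
        rw [Set.mem_Icc]; intro h'; exact h (abs_le.2 ⟨by linarith, by linarith⟩)
    rw [heq]
    refine mul_le_mul_of_nonneg_right ?_ (D.meanValue_nonneg x z v)
    have h1 := D.overlap_le_CG hnt hr hr4 Zρ (fun ρ hρ => ⟨(hZ ρ hρ).1, (hZ ρ hρ).2.1, (hZ ρ hρ).2.2.1⟩) v
    have h2 : 4 * (1 + r * rayLemmaAHeight K 𝔪 v) ≤ 2 * 4 * (r * L') := by
      have := hℒ v hv
      have h3 : r * rayLemmaAHeight K 𝔪 v ≤ r * L' := mul_le_mul_of_nonneg_left this hr.le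
      nlinarith [hu]
    exact h1.trans h2
  have hi1 : IntegrableOn (fun v => ∑ ρ ∈ Zρ, (zeroOrder f ρ : ℝ) *
      (Set.Icc (ρ.im - r / 2) (ρ.im + r / 2)).indicator (D.meanValue x z) v) A :=
    integrable_finsetSum _ fun ρ _ => (hint.indicator measurableSet_Icc).const_mul _
  calc ∫ v in A, ∑ ρ ∈ Zρ, (zeroOrder f ρ : ℝ) *
        (Set.Icc (ρ.im - r / 2) (ρ.im + r / 2)).indicator (D.meanValue x z) v
      ≤ ∫ v in A, (2 * 4 * (r * L')) * D.meanValue x z v :=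
        setIntegral_mono_on hi1 (hint.const_mul _) measurableSet_Icc hpt
    _ = (2 * 4 * (r * L')) * ∫ v in (-T')..T', D.meanValue x z v := by
        rw [integral_const_mul, hA, integral_Icc_eq_integral_Ioc,
          ← intervalIntegral.integral_of_le (by linarith)]

end Literature.NumberTheory.LFunctions

end
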